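import Mathlib.Analysis.Normed.Group.Constructions
import Mathlib.Analysis.Normed.Group.Real
import Mathlib.Algebra.Order.Round
import Mathlib.Algebra.Order.Archimedean.Real.Basic
import HarnessLib

/-!
# Best simultaneous approximation denominators (Lagarias)

For `α ∈ ℝⁿ` and a denominator `q ≥ 1` put
`δ_q(α) = min_{p ∈ ℤⁿ} ‖q α - p‖` for the **sup norm** on `ℝⁿ` [Lagarias1982b, §1 (1.1)].
The *best simultaneous approximation denominators* (BSADs) `1 = q₁ < q₂ < ⋯` of `α` are
defined inductively by `q₁ = 1` and `q_{k+1} =` the least `q` with `δ_q < δ_{q_k}`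
[Lagarias1982b, §1]; equivalently (`isBSAD_one`, `IsBSAD.next`) `q` is a BSAD iff it is a
strict record of `δ`: `δ_{q'} > δ_q` for all `1 ≤ q' < q`. This is the case `k = 1`,
sup norm, of [Chevallier2005, Définition 1] (there for matrices `Θ ∈ M_{d,k}(ℝ)`; the second
clause of that definition is automatic for `k = 1` since `‖-qα‖ = ‖qα‖` mod `ℤⁿ`). For `n = 1`
the BSADs are the denominators of the continued-fraction convergents (Lagrange).

## Main definitions

* `supDist α q` — `δ_q(α)`, as an infimum over `p ∈ ℤⁿ` of the Pi (sup) norm; it is attained at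
  coordinatewise rounding (`supDist_eq_norm_round`), in particular it is a minimum.
* `IsBSAD α q` — `q` is a best simultaneous approximation denominator of `α` (sup norm).

## References

* [Lagarias1982b] J. C. Lagarias, *Best simultaneous Diophantine approximations. II*, Pacific J.
  Math. 102 (1982) 61–88, §1, (1.1)–(1.2).
* [Lagarias1982] J. C. Lagarias, *Best simultaneous Diophantine approximations. I*, Trans. AMS 272
  (1982) 545–554 (same definitions; not held).
* [Chevallier2005] N. Chevallier, Ann. Inst. Fourier 55 (2005) 1635–1657, Définition 1.
-/

namespace Literature.NumberTheory.DiophantineApproximation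

variable {n : Type*} [Fintype n]

/-- `δ_q(α) = min_{p ∈ ℤⁿ} ‖q α - p‖_∞`, the sup-norm distance from `q α` to the integer lattice
[Lagarias1982b, §1 (1.1)]; written as an infimum, which is attained (`supDist_eq_norm_round`).
[cite: Lagarias1982b, §1 (1.1)] -/
noncomputable def supDist (α : n → ℝ) (q : ℕ) : ℝ :=
  ⨅ p : n → ℤ, ‖(q : ℝ) • α - fun i => (p i : ℝ)‖

/-- `δ_q(α) ≤ ‖q α - p‖_∞` for every integer vector `p`. [cite: Lagarias1982b, §1 (1.1)] -/
theorem supDist_le (α : n → ℝ) (q : ℕ) (p : n → ℤ) :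
    supDist α q ≤ ‖(q : ℝ) • α - fun i => (p i : ℝ)‖ :=
  ciInf_le ⟨0, by rintro _ ⟨p', rfl⟩; exact norm_nonneg _⟩ p

/-- `0 ≤ δ_q(α)`. [folklore] -/
theorem supDist_nonneg (α : n → ℝ) (q : ℕ) : 0 ≤ supDist α q :=
  le_ciInf fun _ => norm_nonneg _

/-- The minimum in `δ_q(α)` is attained at coordinatewise rounding:
`δ_q(α) = max_i |q αᵢ - round (q αᵢ)| = max_i ‖q αᵢ‖_{ℝ/ℤ}`. [folklore] -/
theorem supDist_eq_norm_round (α : n → ℝ) (q : ℕ) :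
    supDist α q = ‖fun i => (q : ℝ) * α i - round ((q : ℝ) * α i)‖ := by
  apply le_antisymm
  · have h : (fun i => (q : ℝ) * α i - round ((q : ℝ) * α i)) =
        (q : ℝ) • α - fun i => ((round ((q : ℝ) * α i) : ℤ) : ℝ) := by
      ext i
      simp
    rw [h]
    exact supDist_le α q _
  · refine le_ciInf fun p => (pi_norm_le_iff_of_nonneg (norm_nonneg _)).2 fun i => ?_
    calc ‖(q : ℝ) * α i - round ((q : ℝ) * α i)‖
        ≤ ‖(q : ℝ) * α i - p i‖ := by
          rw [Real.norm_eq_abs, Real.norm_eq_abs]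
          exact round_le _ _
      _ = ‖((q : ℝ) • α - fun i => (p i : ℝ)) i‖ := by simp
      _ ≤ ‖(q : ℝ) • α - fun i => (p i : ℝ)‖ := norm_le_pi_norm _ i

/-- `δ_q(α)` bounds each coordinate's distance to the nearest integer from above. [folklore] -/
theorem abs_sub_round_le_supDist (α : n → ℝ) (q : ℕ) (i : n) :
    |(q : ℝ) * α i - round ((q : ℝ) * α i)| ≤ supDist α q := by
  rw [supDist_eq_norm_round, ← Real.norm_eq_abs]
  exact norm_le_pi_norm (fun i => (q : ℝ) * α i - round ((q : ℝ) * α i)) i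

/-- `q` is a **best simultaneous approximation denominator** (BSAD) of `α ∈ ℝⁿ` for the sup
norm: `q ≥ 1` and `δ_{q'}(α) > δ_q(α)` for all `1 ≤ q' < q` — the strict records of `δ`, i.e.
the terms of Lagarias's sequence `q₁ = 1`, `q_{k+1} = min {q : δ_q < δ_{q_k}}`
[Lagarias1982b, §1]; [Chevallier2005, Définition 1] with `k = 1`.
[cite: Lagarias1982b, §1 (1.1)–(1.2)] -/
def IsBSAD (α : n → ℝ) (q : ℕ) : Prop :=
  0 < q ∧ ∀ q' : ℕ, 0 < q' → q' < q → supDist α q < supDist α q'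

/-- `q₁ = 1` is always a BSAD. [cite: Lagarias1982b, §1] -/
theorem isBSAD_one (α : n → ℝ) : IsBSAD α 1 :=
  ⟨Nat.one_pos, fun q' h h' => by omega⟩

/-- A BSAD is positive. [cite: Lagarias1982b, §1] -/
theorem IsBSAD.pos {α : n → ℝ} {q : ℕ} (h : IsBSAD α q) : 0 < q := h.1

/-- The record property of a BSAD. [cite: Lagarias1982b, §1] -/
theorem IsBSAD.lt {α : n → ℝ} {q : ℕ} (h : IsBSAD α q) {q' : ℕ} (hq' : 0 < q') (hlt : q' < q) :
    supDist α q < supDist α q' :=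
  h.2 q' hq' hlt

/-- Lagarias's inductive step: if `q` is a BSAD and `q⋆ > q` is the least denominator with
`δ_{q⋆} < δ_q`, then `q⋆` is the next BSAD. [cite: Lagarias1982b, §1] -/
theorem IsBSAD.next {α : n → ℝ} {q qs : ℕ} (h : IsBSAD α q) (hq : q < qs)
    (hlt : supDist α qs < supDist α q)
    (hmin : ∀ q'', q < q'' → q'' < qs → supDist α q ≤ supDist α q'') : IsBSAD α qs := by
  refine ⟨lt_of_le_of_lt (Nat.zero_le q) hq, fun q' hq' hq's => ?_⟩
  rcases lt_trichotomy q' q with hlt' | rfl | hgt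
  · exact hlt.trans (h.lt hq' hlt')
  · exact hlt
  · exact hlt.trans_le (hmin q' hgt hq's)

/-- A positive denominator which is not a BSAD is dominated by a smaller one:
`δ_{q'} ≤ δ_q` for some `1 ≤ q' < q`. [folklore] -/
theorem exists_lt_of_not_isBSAD {α : n → ℝ} {q : ℕ} (hq : 0 < q) (h : ¬ IsBSAD α q) :
    ∃ q', 0 < q' ∧ q' < q ∧ supDist α q' ≤ supDist α q := by
  by_contra hcon
  refine h ⟨hq, fun q' hq' hlt => ?_⟩
  by_contra hle
  exact hcon ⟨q', hq', hlt, not_lt.1 hle⟩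

end Literature.NumberTheory.DiophantineApproximation
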